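import Mathlib
import Summits.NavierStokesRegularity.NavierStokesRegularity.Theorems.EulerZoomLiouvillePowerGaugeEulerLiouvilleSelfSimilarSwirlBudget
import Summits.NavierStokesRegularity.NavierStokesRegularity.Theorems.EulerZoomLiouvillePowerGaugeEulerLiouvilleNeedleRace
import Summits.NavierStokesRegularity.NavierStokesRegularity.Theorems.EulerZoomLiouvillePowerGaugeEulerLiouvilleNeedleThinFastExits
import Summits.NavierStokesRegularity.NavierStokesRegularity.Theorems.EulerZoomLiouvillePowerGaugeEulerLiouvilleNeedleRaceMemberPast
import Summits.NavierStokesRegularity.NavierStokesRegularity.Theorems.EulerZoomLiouvillePowerGaugeEulerLiouvilleSelfSimilarIrrotationalGrowth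
import Summits.NavierStokesRegularity.NavierStokesRegularity.Theorems.EulerZoomLiouvillePowerGaugeEulerLiouvilleSelfSimilarShiftedUniformlyContinuous
import HarnessLib

/-!
# Crux E `PowerGaugeEulerLiouville` (stmt-NavierStokesRegularity-19832): A PROFILE-LEVEL LIOUVILLE THEOREM — every AXISYMMETRIC `C²` self-similar Euler
# profile with the two far-field budgets of the class is IDENTICALLY ZERO (width seat ns-ezl-w3 g4; assembly of this seat's swirl budget with the cell's S37 chain)

Route №10 `EulerZoomLiouville` (NavierStokesRegularity), crux E; LEAD ns-typeII-p2 g12.  The member theorems of the lineage speak about Seregin's gauged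
class.  This file records the CLASS-FREE statement they add up to, about the profile alone (the arena of disprover D1 / of the W8 ideation, RESIDUE-MEMO §4 (A3)):

* `integral_curl_sq_closedBall_le_of_budget` — enstrophy growth `∫_{B̄_L}‖curl U‖² ≤ 16·c_E·2^{1−ρ}·L^{1−ρ}` from the gradient budget (bookkeeping);
* **`SwirlBudget.eq_zero_of_axisymmetric_selfSimilarProfile`** — `(U, P)` a `C²` self-similar Euler profile on `ℝ³` (CIV (3.3): `(1−γ)U + (W·∇)U + ∇P = 0`,
  `div U = 0`, `W = γy + U`) with `0 < γ < ½`, `U` AXISYMMETRIC, and the far-field budgets `∫_{B̄_L}‖U‖² ≤ c_A L^{1−2ρ}`, `∫_{B̄_L}‖DU‖² ≤ c_E L^{1−ρ}` for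
  `L ≥ 1` (`0 < ρ ≤ 1`; `γ` and `ρ` independent here) ⇒ `U = 0`.
  Chain: `SwirlBudget.hasNoSwirl_of_budgets` (this seat: no swirl) → `NeedleFastSetMeasure.thinFastExits` (nsreg-p2 plates t39b/c, landed by the width seats:
  symmetry-free thin fast exits from the budgets) → `NeedleRace.curl_eq_zero_of_thinFastExits` (ns-ezl-w2 g3, ROUND-37 (S37): the η-clock race — swirl-free
  axisymmetric + thin exits ⇒ irrotational) → `Loc.eq_zero_of_curl_eq_zero_of_growth` (irrotational + incompressible + sub-volume `L²` growth ⇒ `0`, harmonic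
  Liouville; local growth patched by `Shifted.growth_of_growth_two_le`).

In print: Chae (CMP 2007) and Constantin–Ignatova–Vicol (2026, §4) exclude axisymmetric self-similar Euler profiles under integrability of the swirl / at meridional
fixed points; here the only hypotheses are the two quadratic far-field budgets that every power-gauged blow-up limit carries.  WHAT THIS IS NOT: not NS regularity,
not the crux E (whose needle is now non-axisymmetric about every axis, THE ONE STATEMENT v76) — a profile-level corollary on the MODEL lattice, `--supports`
stmt-19832; 19832 OPEN. [cite: Chae2007CMPEuler, Thm 2.2 + Note added p. 6; ConstantinIgnatovaVicol2026Putative, §3.4–§3.5 and §4.4; GilbargTrudinger2001, Thm 2.1]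
-/

noncomputable section

-- flat `Theorems/<Route><Decl>…` files of one crux share the namespace of the crux (tree convention: `Summit.<S>.<S>.…`)
set_option linter.dupNamespace false

open MeasureTheory Set Filter Topology Metric Function InnerProductSpace
open scoped RealInnerProductSpace NNReal ENNReal ContDiff

namespace Summit.NavierStokesRegularity.NavierStokesRegularity.Theorems.PowerGaugeEulerLiouville

namespace SwirlBudget

open Literature.Analysis Literature.Analysis.FluidPDE Literature.Analysis.FunctionSpaces

variable {γ : ℝ} {U : EuclideanSpace ℝ (Fin 3) → EuclideanSpace ℝ (Fin 3)} {P : EuclideanSpace ℝ (Fin 3) → ℝ}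

/-- Enstrophy growth from the gradient budget on balls: `U ∈ C²`, `∫⁻_{B_L}‖DU‖² ≤ c_E L^{1−ρ}` for `L ≥ 1` ⇒ `∫_{B̄_L}‖curl U‖² ≤ 16 (c_E 2^{1−ρ}) L^{1−ρ}` for
`L ≥ 1` (`NeedleRace.integral_curl_sq_closedBall_le_of_ballGrowth` with `L₁ = 2`). [folklore] -/
theorem integral_curl_sq_closedBall_le_of_budget (hU : ContDiff ℝ 2 U) {ρ cE : ℝ} (hcE : 0 ≤ cE)
    (hE : ∀ L : ℝ, 1 ≤ L → ∫⁻ y in ball (0 : EuclideanSpace ℝ (Fin 3)) L, ‖fderiv ℝ U y‖ₑ ^ 2 ≤ ENNReal.ofReal (cE * L ^ (1 - ρ)))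
    {L : ℝ} (hL : 1 ≤ L) :
    ∫ z in closedBall (0 : EuclideanSpace ℝ (Fin 3)) L, ‖curl U z‖ ^ 2 ≤ 16 * (cE * (2 : ℝ) ^ (1 - ρ)) * L ^ (1 - ρ) := by
  have hgrowth : ∀ L : ℝ, 2 ≤ L → ∫⁻ z in ball (0 : EuclideanSpace ℝ (Fin 3)) L, ‖fderiv ℝ U z‖ₑ ^ 2 ≤
      ENNReal.ofReal cE * ENNReal.ofReal (L ^ (1 - ρ)) := by
    intro L hL
    rw [← ENNReal.ofReal_mul hcE]
    exact hE L (by linarith)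
  have h := NeedleRace.integral_curl_sq_closedBall_le_of_ballGrowth hU (C := ENNReal.ofReal cE) ENNReal.ofReal_ne_top le_rfl hgrowth hL
  rwa [ENNReal.toReal_ofReal hcE] at h

/-- **PROFILE-LEVEL LIOUVILLE THEOREM: AN AXISYMMETRIC `C²` SELF-SIMILAR EULER PROFILE WITH THE TWO FAR-FIELD BUDGETS IS IDENTICALLY ZERO.**
`(U, P)` a self-similar Euler profile about the origin (CIV (3.3)), `0 < γ < ½`, `U` axisymmetric about the `x₂`-axis, `0 < ρ ≤ 1`, and for all `L ≥ 1`: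
`∫⁻_{B̄_L}‖U‖² ≤ c_A L^{1−2ρ}`, `∫⁻_{B̄_L}‖DU‖² ≤ c_E L^{1−ρ}`.  Then `U = 0`.  (No swirl by `hasNoSwirl_of_budgets`; thin fast exits from the budgets by
`NeedleFastSetMeasure.thinFastExits`; irrotational by the (S37) race `NeedleRace.curl_eq_zero_of_thinFastExits`; zero by the harmonic Liouville
`Loc.eq_zero_of_curl_eq_zero_of_growth`.) [cite: Chae2007CMPEuler, Thm 2.2 + Note added p. 6; ConstantinIgnatovaVicol2026Putative, §3.4–§3.5 and §4.4] -/
theorem eq_zero_of_axisymmetric_selfSimilarProfile (h : IsSelfSimilarEulerProfile γ 0 U P) (hU : IsAxisymmetric U)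
    (hγ0 : 0 < γ) (hγ2 : γ < 1 / 2) {ρ cA cE : ℝ} (hρ : 0 < ρ) (hρ1 : ρ ≤ 1) (hcA : 0 ≤ cA) (hcE : 0 ≤ cE)
    (hbA : ∀ L : ℝ, 1 ≤ L →
      ∫⁻ z in closedBall (0 : EuclideanSpace ℝ (Fin 3)) L, ‖U z‖ₑ ^ 2 ≤ ENNReal.ofReal (cA * L ^ (1 - 2 * ρ)))
    (hbE : ∀ L : ℝ, 1 ≤ L →
      ∫⁻ z in closedBall (0 : EuclideanSpace ℝ (Fin 3)) L, ‖fderiv ℝ U z‖ₑ ^ 2 ≤ ENNReal.ofReal (cE * L ^ (1 - ρ))) :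
    U = 0 := by
  have hU2 : ContDiff ℝ 2 U := h.contDiff_velocity
  -- open-ball budgets
  have hA : ∀ L : ℝ, 1 ≤ L → ∫⁻ y in ball (0 : EuclideanSpace ℝ (Fin 3)) L, ‖U y‖ₑ ^ 2 ≤ ENNReal.ofReal (cA * L ^ (1 - 2 * ρ)) :=
    fun L hL => (lintegral_mono_set ball_subset_closedBall).trans (hbA L hL)
  have hE : ∀ L : ℝ, 1 ≤ L → ∫⁻ y in ball (0 : EuclideanSpace ℝ (Fin 3)) L, ‖fderiv ℝ U y‖ₑ ^ 2 ≤ ENNReal.ofReal (cE * L ^ (1 - ρ)) :=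
    fun L hL => (lintegral_mono_set ball_subset_closedBall).trans (hbE L hL)
  -- (1) no swirl
  have hns : HasNoSwirl U :=
    hasNoSwirl_of_budgets h hU hγ0 hγ2 hcA hcE (by linarith : 1 - 2 * ρ < 3) (by linarith : 1 - ρ < 1) hA hE
  -- (2) thin fast exits from the budgets (κ = 1)
  have hthin := NeedleFastSetMeasure.thinFastExits (hU2.of_le one_le_two) hγ0 hρ.le hcA hcE hbA hbE
  -- (3) enstrophy growth and the race: irrotational
  have hcurl : ∀ L : ℝ, 1 ≤ L →
      ∫ z in closedBall (0 : EuclideanSpace ℝ (Fin 3)) L, ‖curl U z‖ ^ 2 ≤ 16 * (cE * (2 : ℝ) ^ (1 - ρ)) * L ^ (1 - ρ) :=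
    fun L hL => integral_curl_sq_closedBall_le_of_budget hU2 hcE hE hL
  have hc0 : ∀ x, curl U x = 0 := fun x =>
    NeedleRace.curl_eq_zero_of_thinFastExits h hγ0 hγ2 hU hns (q := 1 - ρ) (by linarith) hcurl one_pos hthin x
  -- (4) harmonic Liouville with sub-volume `L²` growth
  have hgr2 : ∀ L : ℝ, 2 ≤ L → ∫⁻ y in ball (0 : EuclideanSpace ℝ (Fin 3)) L, ‖U y‖ₑ ^ 2 ≤
      ENNReal.ofReal cA * ENNReal.ofReal (L ^ (1 - 2 * ρ)) := by
    intro L hL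
    rw [← ENNReal.ofReal_mul hcA]
    exact hA L (by linarith)
  obtain ⟨C', hC', hgr⟩ := Shifted.growth_of_growth_two_le hU2.continuous (θ := 1 - 2 * ρ) (by linarith) ENNReal.ofReal_ne_top hgr2
  exact Loc.eq_zero_of_curl_eq_zero_of_growth hU2 hc0 h.divFree hC' (by linarith : 1 - 2 * ρ < 3) hgr

end SwirlBudget

end Summit.NavierStokesRegularity.NavierStokesRegularity.Theorems.PowerGaugeEulerLiouville

end
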